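import Mathlib
import HarnessLib

/-!
# The Maurer–Cartan identity for left-trivialised forms —
crux HeckeEigenvalueField (stmt-Langlands-13632), line Sketch, stub DICT-W2

Statement.  Let `𝔸` be a complete normed real algebra (in the application `𝔸 = M_n(K_∞)`),
`V` a real normed space and `Φ : 𝔸 → 𝔸 [⋀^Fin (q+1)]→L[ℝ] V` a map into continuous alternating
`(q+1)`-forms, differentiable at a unit `g`.  The *left-trivialised* form attached to `Φ` is
`ω̃ x := (Φ x).compContinuousLinearMap (mul (x⁻¹ʳ))`, i.e.
`ω̃(x)(Y₀,…,Y_q) = Φ(x)(x⁻¹Y₀,…,x⁻¹Y_q)` on the open set of units.  Then the flat exterior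
derivative (Mathlib's `extDeriv`, normalised as in `extDeriv_apply`) of `ω̃` at `g`, evaluated on
left-translated vectors `g X₀, …, g X_{q+1}`, is the Chevalley–Eilenberg expression
```
  Σᵢ (-1)ⁱ (D_{gXᵢ}Φ)(g)(X₀,…,X̂ᵢ,…) + Σ_{i<k} (-1)^{i+k} Φ(g)([Xᵢ,X_k], X₀,…,X̂ᵢ,…,X̂_k,…),
```
`[X,Y] = XY - YX`, the pairs `i < k` being enumerated as `(i, i.succAbove j)`.

Proof idea.  `extDeriv_apply` expresses `dω̃(g; v)` through the derivatives of the evaluations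
`x ↦ ω̃ x (v ∘ i.succAbove) = Φ x (x⁻¹ v ∘ i.succAbove)`; these are computed by the Leibniz
rule `fderiv_continuousAlternatingMap_apply_apply` and the derivative of `Ring.inverse`
(`fderiv_inverse`: `D_Y(x⁻¹) = -x⁻¹ Y x⁻¹`), which on `v = gX` produces the terms
`Φ(g)(…, -Xᵢ X_k in slot k, …)`.  Moving that slot to the front costs the sign `(-1)^{position}`
(`AlternatingMap.map_insertNth`), and the resulting sum over ordered pairs `(i, k)`, `i ≠ k`, is
folded onto the pairs `i < k` with the involution `(i, j) ↦ (i.succAbove j, j.predAbove i)`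
(`Fin.succAbove_succAbove_predAbove`, `Fin.succAbove_succAbove_succAbove_predAbove`), the two
members of an orbit combining into the commutator by linearity in the front slot.

This is the computation behind "`dω̃ = 0 ⇔ dη = 0`" in the Borel–Wallach dictionary between
`(𝔤, K)`-cochains and left-invariantly trivialised differential forms.
Reference: A. Borel, N. Wallach, *Continuous cohomology, discrete subgroups, and representations
of reductive groups*, 2nd ed. (2000), VII 2.2 [BorelWallach2000].
-/

set_option linter.dupNamespace false -- project-wide: `Summit.Langlands.Langlands` is the mandated namespace

noncomputable section

namespace Summit.Langlands.Langlands.Theorems.HeckeEigenvalueField.Res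

/-- The integer sign `(-1 : ℤ) ^ m` acting on a module agrees with the scalar sign
`(-1 : R) ^ m`. [folklore] -/
private theorem neg_one_pow_zsmul_eq {R V : Type*} [Ring R] [AddCommGroup V] [Module R V]
    (m : ℕ) (y : V) : ((-1 : ℤ) ^ m) • y = ((-1 : R) ^ m) • y := by
  rw [← Int.cast_smul_eq_zsmul R]
  simp

/-- Folding a sum over ordered pairs of distinct indices onto increasing pairs.  A pair
`(i, j) : Fin (n+2) × Fin (n+1)` encodes the ordered pair of distinct indices `(i, i.succAbove j)`;
the involution `(i, j) ↦ (i.succAbove j, j.predAbove i)` swaps the two indices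
(`Fin.succAbove_succAbove_predAbove`), so `Σ_{i,j} F i j` is the sum over the pairs with
`i < i.succAbove j` of `F i j + F (i.succAbove j) (j.predAbove i)`. [folklore] -/
private theorem sum_sum_eq_sum_sum_ite_add {N : Type*} [AddCommMonoid N] {n : ℕ}
    (F : Fin (n + 2) → Fin (n + 1) → N) :
    ∑ i : Fin (n + 2), ∑ j : Fin (n + 1), F i j =
      ∑ i : Fin (n + 2), ∑ j : Fin (n + 1),
        if (i : ℕ) < ((i.succAbove j : Fin (n + 2)) : ℕ) then
          F i j + F (i.succAbove j) (j.predAbove i) else 0 := by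
  -- the involution exchanging the roles of the two removed indices
  let τ : Fin (n + 2) × Fin (n + 1) → Fin (n + 2) × Fin (n + 1) := fun p =>
    (p.1.succAbove p.2, p.2.predAbove p.1)
  have hτ : Function.Involutive τ := fun p =>
    Prod.ext (Fin.succAbove_succAbove_predAbove p.1 p.2) (Fin.predAbove_predAbove_succAbove p.1 p.2)
  have hPτ : ∀ p : Fin (n + 2) × Fin (n + 1),
      (((τ p).1 : ℕ) < (((τ p).1.succAbove (τ p).2 : Fin (n + 2)) : ℕ)) ↔
        ¬ ((p.1 : ℕ) < ((p.1.succAbove p.2 : Fin (n + 2)) : ℕ)) := by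
    intro p
    simp only [τ, Fin.succAbove_succAbove_predAbove]
    have h := Fin.val_ne_of_ne (Fin.succAbove_ne p.1 p.2)
    omega
  rw [← Fintype.sum_prod_type', ← Fintype.sum_prod_type']
  calc ∑ p : Fin (n + 2) × Fin (n + 1), F p.1 p.2
      = ∑ p : Fin (n + 2) × Fin (n + 1),
          ((if (p.1 : ℕ) < ((p.1.succAbove p.2 : Fin (n + 2)) : ℕ) then F p.1 p.2 else 0) +
            (if (p.1 : ℕ) < ((p.1.succAbove p.2 : Fin (n + 2)) : ℕ) then 0 else F p.1 p.2)) :=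
        Finset.sum_congr rfl fun p _ => by split_ifs <;> simp
    _ = (∑ p : Fin (n + 2) × Fin (n + 1),
          if (p.1 : ℕ) < ((p.1.succAbove p.2 : Fin (n + 2)) : ℕ) then F p.1 p.2 else 0) +
          ∑ p : Fin (n + 2) × Fin (n + 1),
            if (p.1 : ℕ) < ((p.1.succAbove p.2 : Fin (n + 2)) : ℕ) then 0 else F p.1 p.2 :=
        Finset.sum_add_distrib
    _ = (∑ p : Fin (n + 2) × Fin (n + 1),
          if (p.1 : ℕ) < ((p.1.succAbove p.2 : Fin (n + 2)) : ℕ) then F p.1 p.2 else 0) +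
          ∑ p : Fin (n + 2) × Fin (n + 1),
            if ((τ p).1 : ℕ) < (((τ p).1.succAbove (τ p).2 : Fin (n + 2)) : ℕ) then 0
            else F (τ p).1 (τ p).2 := by
        congr 1
        exact (Fintype.sum_equiv hτ.toPerm _ _ fun p => rfl).symm
    _ = (∑ p : Fin (n + 2) × Fin (n + 1),
          if (p.1 : ℕ) < ((p.1.succAbove p.2 : Fin (n + 2)) : ℕ) then F p.1 p.2 else 0) +
          ∑ p : Fin (n + 2) × Fin (n + 1),
            if (p.1 : ℕ) < ((p.1.succAbove p.2 : Fin (n + 2)) : ℕ) then F (τ p).1 (τ p).2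
            else 0 := by
        congr 1
        refine Finset.sum_congr rfl fun p _ => ?_
        rw [if_congr (hPτ p) rfl rfl, ite_not]
    _ = ∑ p : Fin (n + 2) × Fin (n + 1),
          ((if (p.1 : ℕ) < ((p.1.succAbove p.2 : Fin (n + 2)) : ℕ) then F p.1 p.2 else 0) +
            (if (p.1 : ℕ) < ((p.1.succAbove p.2 : Fin (n + 2)) : ℕ) then F (τ p).1 (τ p).2
              else 0)) := Finset.sum_add_distrib.symm
    _ = _ := Finset.sum_congr rfl fun p _ => by split_ifs <;> simp [τ]

/-- The combinatorial heart of the Maurer–Cartan identity.  For an alternating `(n+1)`-form `f`,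
a tuple `X : Fin (n+2) → M` and a "product" `B : Fin (n+2) → Fin (n+2) → M`, the signed sum over
`i` of the Leibniz terms `f (X ∘ i.succAbove with -B i k put in the slot of k)`
(`k = i.succAbove j`) equals the Chevalley–Eilenberg sum over increasing pairs `i < k` of
`(-1)^{i+k} f (B i k - B k i, X with i and k removed)`: move the modified slot to the front
(`AlternatingMap.map_insertNth`, sign `(-1)^j`), fold ordered pairs onto increasing pairs
(`sum_sum_eq_sum_sum_ite_add`), and use linearity in the front slot. [folklore] -/
private theorem sum_smul_sum_map_update_eq {R M N : Type*} [CommRing R] [AddCommGroup M]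
    [Module R M] [AddCommGroup N] [Module R N] {n : ℕ} (f : M [⋀^Fin (n + 1)]→ₗ[R] N)
    (X : Fin (n + 2) → M) (B : Fin (n + 2) → Fin (n + 2) → M) :
    ∑ i : Fin (n + 2), (-1 : R) ^ (i : ℕ) • ∑ j : Fin (n + 1),
        f (Function.update (fun l => X (i.succAbove l)) j (-(B i (i.succAbove j)))) =
      ∑ i : Fin (n + 2), ∑ j : Fin (n + 1),
        if (i : ℕ) < ((i.succAbove j : Fin (n + 2)) : ℕ) then
          ((-1 : R) ^ ((i : ℕ) + ((i.succAbove j : Fin (n + 2)) : ℕ))) •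
            f (Fin.cons (B i (i.succAbove j) - B (i.succAbove j) i)
              (fun l => X (i.succAbove (j.succAbove l))))
        else 0 := by
  -- Step 1: move the updated slot to the front.
  have h1 : ∀ (i : Fin (n + 2)) (j : Fin (n + 1)) (w : M),
      f (Function.update (fun l => X (i.succAbove l)) j w) =
        (-1 : R) ^ (j : ℕ) • f (Fin.cons w (fun l => X (i.succAbove (j.succAbove l)))) := by
    intro i j w
    rw [← Fin.insertNth_removeNth, AlternatingMap.map_insertNth, neg_one_pow_zsmul_eq (R := R)]
    rfl
  -- linearity in the front slot
  have hneg : ∀ (w : M) (r : Fin n → M), f (Fin.cons (-w) r) = -f (Fin.cons w r) := by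
    intro w r
    have := f.map_vecCons_smul r (-1) w
    simpa [Matrix.vecCons] using this
  have hsub : ∀ (w w' : M) (r : Fin n → M),
      f (Fin.cons (w - w') r) = f (Fin.cons w r) - f (Fin.cons w' r) := by
    intro w w' r
    have := f.map_vecCons_add r w (-w')
    simpa [Matrix.vecCons, sub_eq_add_neg, hneg] using this
  -- Step 2: signed double sum over ordered pairs, then fold onto increasing pairs.
  calc (∑ i : Fin (n + 2), (-1 : R) ^ (i : ℕ) • ∑ j : Fin (n + 1),
        f (Function.update (fun l => X (i.succAbove l)) j (-(B i (i.succAbove j)))))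
      = ∑ i : Fin (n + 2), ∑ j : Fin (n + 1), (-1 : R) ^ ((i : ℕ) + (j : ℕ) + 1) •
          f (Fin.cons (B i (i.succAbove j)) (fun l => X (i.succAbove (j.succAbove l)))) := by
        refine Finset.sum_congr rfl fun i _ => ?_
        rw [Finset.smul_sum]
        refine Finset.sum_congr rfl fun j _ => ?_
        rw [h1, hneg, smul_neg, smul_neg, ← neg_smul, smul_smul]
        congr 1
        ring
    _ = _ := by
        rw [sum_sum_eq_sum_sum_ite_add]
        refine Finset.sum_congr rfl fun i _ => Finset.sum_congr rfl fun j _ => ?_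
        split_ifs with hij
        · -- the ordered pair `(i, i.succAbove j)` together with its mirror image
          have hij' : i < i.succAbove j := Fin.lt_def.mpr hij
          have hle : i ≤ Fin.castSucc j := (Fin.lt_succAbove_iff_le_castSucc i j).mp hij'
          have hk : ((i.succAbove j : Fin (n + 2)) : ℕ) = (j : ℕ) + 1 := by
            rw [Fin.succAbove_of_le_castSucc _ _ hle, Fin.val_succ]
          have hj' : ((j.predAbove i : Fin (n + 1)) : ℕ) = (i : ℕ) := by
            rw [Fin.predAbove_of_le_castSucc _ _ hle, Fin.coe_castPred]
          simp only [Fin.succAbove_succAbove_predAbove,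
            Fin.succAbove_succAbove_succAbove_predAbove, hk, hj', hsub, smul_sub]
          have e1 : (-1 : R) ^ ((j : ℕ) + 1 + (i : ℕ) + 1) = -(-1) ^ ((i : ℕ) + ((j : ℕ) + 1)) := by
            ring
          have e2 : (-1 : R) ^ ((i : ℕ) + (j : ℕ) + 1) = (-1) ^ ((i : ℕ) + ((j : ℕ) + 1)) := by
            ring
          rw [e1, e2, neg_smul, sub_eq_add_neg]
        · rfl

/-- **Dictionary calculus W2 (Maurer–Cartan identity for left-trivialised forms).**
Let `𝔸` be a complete normed real algebra, `Φ : 𝔸 → 𝔸 [⋀^Fin (q+1)]→L[ℝ] V` differentiable at a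
unit `g`, and `ω̃ x := (Φ x).compContinuousLinearMap (mul x⁻¹ʳ)` the left-trivialised form
`ω̃(x)(Y) = Φ(x)(x⁻¹Y)`.  Then
`dω̃(g)(gX₀,…,gX_{q+1}) = Σᵢ (-1)ⁱ (D_{gXᵢ}Φ)(g)(X ∘ i.succAbove)
  + Σᵢ Σⱼ [i < i.succAbove j] (-1)^{i + i.succAbove j}
      Φ(g)([Xᵢ, X_{i.succAbove j}], X ∘ i.succAbove ∘ j.succAbove)`
with `[X, Y] = XY - YX`: the flat exterior derivative of the left-trivialised form on
left-translated vectors is the Chevalley–Eilenberg differential.  Proof: `extDeriv_apply`, the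
Leibniz rule `fderiv_continuousAlternatingMap_apply_apply` with `fderiv_inverse`
(`D_Y x⁻¹ = -x⁻¹Yx⁻¹`, so the slot terms are `-XᵢX_k`), and the pair-folding lemma
`sum_smul_sum_map_update_eq`. [cite: BorelWallach2000, VII 2.2] -/
theorem stub_extDeriv_leftTrivialised
    {𝔸 V : Type} [NormedRing 𝔸] [NormedAlgebra ℝ 𝔸] [CompleteSpace 𝔸]
    [NormedAddCommGroup V] [NormedSpace ℝ V] {q : ℕ}
    (Φ : 𝔸 → 𝔸 [⋀^Fin (q + 1)]→L[ℝ] V) (g : 𝔸ˣ) (hΦ : DifferentiableAt ℝ Φ (g : 𝔸))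
    (X : Fin (q + 2) → 𝔸) :
    extDeriv (fun x : 𝔸 => (Φ x).compContinuousLinearMap (ContinuousLinearMap.mul ℝ 𝔸 (Ring.inverse x)))
        (g : 𝔸) (fun i => (g : 𝔸) * X i) =
      (∑ i : Fin (q + 2),
          ((-1 : ℝ) ^ (i : ℕ)) • (fderiv ℝ Φ (g : 𝔸) ((g : 𝔸) * X i)) (fun j => X (i.succAbove j))) +
        ∑ i : Fin (q + 2), ∑ j : Fin (q + 1),
          if (i : ℕ) < ((i.succAbove j : Fin (q + 2)) : ℕ) then
            ((-1 : ℝ) ^ ((i : ℕ) + ((i.succAbove j : Fin (q + 2)) : ℕ))) •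
              (Φ (g : 𝔸)) (Fin.cons (X i * X (i.succAbove j) - X (i.succAbove j) * X i)
                (fun l => X (i.succAbove (j.succAbove l))))
          else 0 := by
  set ω : 𝔸 → 𝔸 [⋀^Fin (q + 1)]→L[ℝ] V := fun x =>
    (Φ x).compContinuousLinearMap (ContinuousLinearMap.mul ℝ 𝔸 (Ring.inverse x)) with hω_def
  set v : Fin (q + 2) → 𝔸 := fun i => (g : 𝔸) * X i with hv
  -- `ω̃` is differentiable at the unit `g`
  have hL : DifferentiableAt ℝ (fun x : 𝔸 => ContinuousLinearMap.mul ℝ 𝔸 (Ring.inverse x))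
      (g : 𝔸) :=
    (ContinuousLinearMap.mul ℝ 𝔸).differentiableAt.comp _ (differentiableAt_inverse g.isUnit)
  have hω : DifferentiableAt ℝ ω (g : 𝔸) := hΦ.continuousAlternatingMapCompContinuousLinearMap hL
  rw [extDeriv_apply hω]
  -- the derivative of each evaluation `x ↦ ω̃ x (v ∘ i.succAbove)` in the direction `g Xᵢ`
  have key : ∀ i : Fin (q + 2),
      fderiv ℝ (fun x => ω x (i.removeNth v)) (g : 𝔸) (v i) =
        fderiv ℝ Φ (g : 𝔸) ((g : 𝔸) * X i) (fun j => X (i.succAbove j)) +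
          ∑ j : Fin (q + 1), Φ (g : 𝔸)
            (Function.update (fun l => X (i.succAbove l)) j (-(X i * X (i.succAbove j)))) := by
    intro i
    have hcomp : (fun x => ω x (i.removeNth v)) =
        fun x => Φ x (fun j => Ring.inverse x * ((g : 𝔸) * X (i.succAbove j))) := by
      funext x
      simp [hω_def, hv, Function.comp_def, Fin.removeNth_apply]
    rw [hcomp, hv]
    refine (fderiv_continuousAlternatingMap_apply_apply
      (g := fun j x => Ring.inverse x * ((g : 𝔸) * X (i.succAbove j))) hΦ
      (fun j => (differentiableAt_inverse g.isUnit).mul_const _) _).trans ?_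
    simp [fderiv_mul_const' (differentiableAt_inverse (𝕜 := ℝ) g.isUnit), fderiv_inverse,
      mul_assoc]
  simp only [key, neg_one_pow_zsmul_eq (R := ℝ), smul_add, Finset.sum_add_distrib]
  congr 1
  -- the slot terms fold onto the Chevalley–Eilenberg commutator sum
  have := sum_smul_sum_map_update_eq (R := ℝ) (Φ (g : 𝔸)).toAlternatingMap X (fun a b => X a * X b)
  simpa only [ContinuousAlternatingMap.coe_toAlternatingMap] using this

end Summit.Langlands.Langlands.Theorems.HeckeEigenvalueField.Res

end
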